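import Literature.Probability.LatticeModels.GarbanSpencerXYLongRangeOrderProofs
import Literature.Probability.LatticeModels.UnitChainPushforward
import HarnessLib

/-!
# RP-free long-range order of the `(2+1)`-dimensional XY rotor on `(ℤ/L)² × ℤ/M`:
# I. Near pairs (Garban–Spencer's path estimator run through imaginary time)

BC5 witness (first rung) for the crux `BirComplexStableXYR` (stmt-HubbardSuperconductivity-14845) of
route `BalabanIR`: the real nearest-neighbour XY table on the space-time torus
`Λ = (ℤ/L)² × (ℤ/M)` — the discrete-imaginary-time integer-filling quantum rotor
`exp(K ∑_s [cos(θ_s − θ_{s+e₁}) + cos(θ_s − θ_{s+e₂}) + cos(θ_s − θ_{s+e_τ})])` — has equal-time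
long-range order for `K ≥ K₀`, uniformly in `M ≥ L`, proved WITHOUT reflection positivity,
WITHOUT parity restrictions on `L, M`, by the Bayesian path-estimator method of
C. Garban, T. Spencer, *Continuous symmetry breaking along the Nishimori line*, J. Math. Phys. 63
(2022) 093302 (arXiv:2109.01617), Theorem 1.3 with Remark 1 (as formalised in the tree for the XY
model on free boxes of `ℤ^d`, `d ≥ 3`: `GarbanSpencerXYLongRangeOrderProofs`).

The spatial dimension is `2`, so Garban–Spencer's unpredictable ball paths (which need three
lattice directions) are run in SPACE-TIME `ℤ³ ↠ (ℤ/L)² × ℤ/M`: this file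

* pushes unit-chain ensembles of a region `Λ ⊂ ℤ^d` forward along any lattice map
  `g : ℤ^d → (ℤ/L)^{d'} × ℤ/M` compatible with unit steps and injective on `Λ`
  (`exists_unitChain_latticeBonds_to_spaceTime`, the space-time version of the tree's
  `exists_unitChain_latticeBonds_to_torus`);
* shows that the space-time projection `ℤ³ → (ℤ/L)² × ℤ/M` is injective on Garban–Spencer's ball
  `B((x+y)/2, 2‖x − y‖₂)` of two equal-time points with `16‖x − y‖₂² < L² ≤ M²`
  (`spaceTimeProj_injOn_of_ball`);
* proves the NEAR-PAIR bound (`xyRotor_near_twoPoint`): there are `C, K₁ > 0` with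
  `1 − ⟨cos(θ_{(πx,0)} − θ_{(πy,0)})⟩_K ≤ √(C/K)` for all `K ≥ K₁`, all `L ≤ M` and all
  `x, y ∈ ℤ²` with `16‖x − y‖₂² < L²`.

Files II–III (`…RotorWitnessChain`, `…RotorWitness`) chain near pairs to all equal-time pairs and
translate to the crux's angle-cube vocabulary.

## References
* C. Garban, T. Spencer, J. Math. Phys. 63 (2022) 093302, arXiv:2109.01617: Thm. 1.3, Remark 1,
  Lemma 2.5, proof of Thm. 1.3 Steps 1–2. [GarbanSpencer2022]
* J. Fröhlich, T. Spencer, Comm. Math. Phys. 83 (1982) 411–454 (the first RP-free proof of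
  long-range order for the `d = 3` rotator, by duality and energy–entropy). [FrohlichSpencerCMP1982]
-/

noncomputable section

set_option linter.dupNamespace false -- summit = problem name (single-conjunct summit), D-0017

namespace Summit.HubbardSuperconductivity.HubbardSuperconductivity.Theorems

open MeasureTheory Finset
open scoped BigOperators
open Literature.Probability.LatticeModels BallPath DyadicWalk Trail

/-! ### Pushforward of path ensembles of `ℤ^d` to a space-time torus -/

/-- **Ball-path ensembles on the space-time torus.** Let `g : ℤ^d → (ℤ/L)^{d'} × ℤ/M` send unit
steps to unit steps (`g (z + eᵢ) = g z + e_{dir i}` with `dir` injective on directions) and be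
injective on `Λ ⊂ ℤ^d`. Then every family of unit chains from `x` to `y` on the free bond system
`latticeBonds Λ` gives a family of unit chains from `g x` to `g y` on the bond system of the
space-time torus, with the same pairwise overlaps (the space-time version of the tree's
`exists_unitChain_latticeBonds_to_torus`). [folklore] -/
theorem exists_unitChain_latticeBonds_to_spaceTime {d d' L M : ℕ} [NeZero L] [NeZero M]
    (Λ : Finset (Site d)) (g : Site d → JCurrent.SpaceTimeSite d' L M) (dir : Fin d → JCurrent.Dir d')
    (hdir : Function.Injective dir)
    (hstep : ∀ (z : Site d) (i : Fin d), g (z + Pi.single i 1) = g z + JCurrent.unitVec (dir i))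
    (hinj : Set.InjOn g (Λ : Set (Site d))) {x y : ↥Λ} {S : Type*}
    (Tch : S → (latticeBonds Λ).UnitChain x y) :
    ∃ T' : S → (JCurrent.bondSystem d' L M).UnitChain (g (x : Site d)) (g (y : Site d)),
      ∀ s s', (T' s).overlap (T' s') = (Tch s).overlap (Tch s') := by
  classical
  let G := latticeBonds Λ
  let G' := JCurrent.bondSystem d' L M
  let g' : ↥Λ → JCurrent.SpaceTimeSite d' L M := fun z => g (z : Site d)
  -- source, target, axis and orientation of a bond of `Λ`
  set u : ↥(edgesIn (zdGraph d) Λ) → Site d := fun a => (G.src a : Site d) with hu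
  set w : ↥(edgesIn (zdGraph d) Λ) → Site d := fun a => (G.tgt a : Site d) with hw
  have hadj : ∀ a, ∃ i : Fin d, w a = u a + Pi.single i 1 ∨ u a = w a + Pi.single i 1 := by
    intro a
    have h := (mem_edgesIn_iff.1 a.2).1
    rw [← mk_src_tgt Λ a, SimpleGraph.mem_edgeSet] at h
    exact (zdGraph_adj_iff _ _).1 h
  choose i hi using hadj
  set fwd : ↥(edgesIn (zdGraph d) Λ) → Prop := fun a => w a = u a + Pi.single (i a) 1 with hfwd
  have hbwd : ∀ a, ¬ fwd a → u a = w a + Pi.single (i a) 1 := fun a h => (hi a).resolve_left h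
  set f : ↥(edgesIn (zdGraph d) Λ) → JCurrent.Bond d' L M := fun a =>
    if fwd a then (g (u a), dir (i a)) else (g (w a), dir (i a)) with hf
  set ε : ↥(edgesIn (zdGraph d) Λ) → ℤ := fun a => if fwd a then 1 else -1 with hε
  have hε1 : ∀ a, ε a = 1 ∨ ε a = -1 := fun a => by simp only [hε]; split_ifs <;> simp
  -- compatibility of the bond characters
  have hcompat : ∀ a (θ' : JCurrent.SpaceTimeSite d' L M → Circle),
      ((G'.bondChar (f a) θ' : Circle) : ℂ) = ((G.bondChar a (θ' ∘ g') : Circle) : ℂ) ^ ε a := by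
    intro a θ'
    simp only [hf, hε]
    by_cases h : fwd a
    · rw [if_pos h, if_pos h, zpow_one, BondSystem.bondChar_apply, BondSystem.bondChar_apply,
        BondSystem.bondVar_one, BondSystem.bondVar_one]
      show (((θ' (g (u a)))⁻¹ * θ' (g (u a) + JCurrent.unitVec (dir (i a))) : Circle) : ℂ) =
        (((θ' (g' (G.src a)))⁻¹ * θ' (g' (G.tgt a)) : Circle) : ℂ)
      rw [← hstep]
      have : u a + Pi.single (i a) 1 = w a := h.symm
      rw [this]
    · rw [if_neg h, if_neg h, BondSystem.bondChar_apply, BondSystem.bondChar_apply,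
        BondSystem.bondVar_one, BondSystem.bondVar_one, zpow_neg, zpow_one, ← Circle.coe_inv, mul_inv_rev,
        inv_inv]
      show (((θ' (g (w a)))⁻¹ * θ' (g (w a) + JCurrent.unitVec (dir (i a))) : Circle) : ℂ) =
        (((θ' (g' (G.tgt a)))⁻¹ * θ' (g' (G.src a)) : Circle) : ℂ)
      rw [← hstep, ← hbwd a h]
  -- injectivity of the bond map
  have hmemu : ∀ a, u a ∈ (Λ : Set (Site d)) := fun a => (G.src a).2
  have hmemw : ∀ a, w a ∈ (Λ : Set (Site d)) := fun a => (G.tgt a).2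
  have hedge : ∀ a : ↥(edgesIn (zdGraph d) Λ), (a : Sym2 (Site d)) = s(u a, w a) :=
    fun a => (mk_src_tgt Λ a).symm
  have hfinj : Function.Injective f := by
    intro a b hab
    simp only [hf] at hab
    apply Subtype.ext
    rw [hedge, hedge]
    by_cases ha : fwd a <;> by_cases hb : fwd b <;>
      simp only [ha, hb, if_true, if_false, Prod.mk.injEq] at hab <;> obtain ⟨hp, hii⟩ := hab <;>
      have hii' := hdir hii
    · have hp' := hinj (hmemu a) (hmemu b) hp
      rw [ha, hb, ← hii', hp']
    · have hp' := hinj (hmemu a) (hmemw b) hp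
      rw [ha, hbwd b hb, ← hii', hp', Sym2.eq_swap]
    · have hp' := hinj (hmemw a) (hmemu b) hp
      rw [hbwd a ha, hb, ← hii', hp', Sym2.eq_swap]
    · have hp' := hinj (hmemw a) (hmemw b) hp
      rw [hbwd a ha, hbwd b hb, ← hii', hp']
  exact G.exists_unitChain_map G' g' hfinj ε hε1 hcompat Tch

/-! ### The space-time projection `ℤ³ → (ℤ/L)² × ℤ/M` -/

/-- The three lattice directions of `ℤ³ = ℤ² × ℤ` as space-time directions of `(ℤ/L)² × ℤ/M`
(`![some 0, some 1, none]`: the last axis is imaginary time) are pairwise distinct. [folklore] -/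
theorem spaceTimeDir_injective :
    Function.Injective (![some 0, some 1, none] : Fin 3 → JCurrent.Dir 2) := by
  decide

/-- **Unit steps project to unit steps**: the space-time projection
`z ↦ (π_L (z₀, z₁), z₂ mod M)` sends `z + eᵢ` to the projection of `z` plus the space-time unit
vector of direction `i` (spatial for `i < 2`, temporal for `i = 2`). [folklore] -/
theorem spaceTimeProj_step (L M : ℕ) (z : Site 3) (i : Fin 3) :
    ((Torus.proj L (fun j : Fin 2 => (z + Pi.single i 1 : Site 3) (Fin.castSucc j)),
        (((z + Pi.single i 1 : Site 3) (Fin.last 2) : ℤ) : ZMod M)) : JCurrent.SpaceTimeSite 2 L M) =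
      ((Torus.proj L (fun j : Fin 2 => z (Fin.castSucc j)), ((z (Fin.last 2) : ℤ) : ZMod M)) :
        JCurrent.SpaceTimeSite 2 L M) +
        JCurrent.unitVec ((![some 0, some 1, none] : Fin 3 → JCurrent.Dir 2) i) := by
  fin_cases i
  · refine Prod.ext ?_ ?_
    · funext j
      fin_cases j <;> simp [JCurrent.unitVec, Torus.proj_apply, Pi.single_apply]
    · simp [JCurrent.unitVec]
  · refine Prod.ext ?_ ?_
    · funext j
      fin_cases j <;> simp [JCurrent.unitVec, Torus.proj_apply, Pi.single_apply]
    · simp [JCurrent.unitVec]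
  · refine Prod.ext ?_ ?_
    · funext j
      fin_cases j <;> simp [JCurrent.unitVec, Torus.proj_apply, Pi.single_apply]
    · simp [JCurrent.unitVec]

/-- **Garban–Spencer's ball of two equal-time points projects injectively into the space-time
torus**: if `16‖x − y‖₂² < L²` and `L ≤ M`, the space-time projection is injective on every
`Λ ⊂ B((x̃+ỹ)/2, 2‖x − y‖₂) ⊂ ℤ³` (`x̃ = (x, 0)`, `ỹ = (y, 0)`). [folklore] -/
theorem spaceTimeProj_injOn_of_ball {L M : ℕ} (hLM : L ≤ M) (x y : Site 3)
    (hL : 16 * ∑ i, ((x i : ℝ) - (y i : ℝ)) ^ 2 < (L : ℝ) ^ 2) (Λ : Finset (Site 3))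
    (hΛ : ∀ z ∈ Λ, (∑ i, ((z i : ℝ) - ((x i : ℝ) + (y i : ℝ)) / 2) ^ 2) ≤ 4 * ∑ i, ((x i : ℝ) - (y i : ℝ)) ^ 2) :
    Set.InjOn (fun z : Site 3 => ((Torus.proj L (fun j : Fin 2 => z (Fin.castSucc j)),
        ((z (Fin.last 2) : ℤ) : ZMod M)) : JCurrent.SpaceTimeSite 2 L M)) (Λ : Set (Site 3)) := by
  intro z hz z' hz' hzz
  simp only [Prod.mk.injEq] at hzz
  -- every coordinate difference is `< L ≤ M` in absolute value
  set D : ℝ := ∑ i, ((x i : ℝ) - (y i : ℝ)) ^ 2 with hD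
  set c : Fin 3 → ℝ := fun i => ((x i : ℝ) + (y i : ℝ)) / 2 with hc
  have hlt : ∀ k : Fin 3, |z' k - z k| < (L : ℤ) := by
    intro k
    have b1 : ((z k : ℝ) - c k) ^ 2 ≤ 4 * D :=
      (Finset.single_le_sum (f := fun i => ((z i : ℝ) - c i) ^ 2) (fun i _ => sq_nonneg _)
        (Finset.mem_univ k)).trans (hΛ z (Finset.mem_coe.1 hz))
    have b2 : ((z' k : ℝ) - c k) ^ 2 ≤ 4 * D :=
      (Finset.single_le_sum (f := fun i => ((z' i : ℝ) - c i) ^ 2) (fun i _ => sq_nonneg _)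
        (Finset.mem_univ k)).trans (hΛ z' (Finset.mem_coe.1 hz'))
    have b3 : ((z' k : ℝ) - (z k : ℝ)) ^ 2 < (L : ℝ) ^ 2 := by
      nlinarith [sq_nonneg (((z' k : ℝ) - c k) + ((z k : ℝ) - c k))]
    have b4 : |(z' k : ℝ) - (z k : ℝ)| < L := abs_lt_of_sq_lt_sq b3 (Nat.cast_nonneg L)
    have h := abs_lt.1 b4
    rw [abs_lt]
    constructor
    · exact_mod_cast h.1
    · exact_mod_cast h.2
  funext k
  induction k using Fin.lastCases with
  | last =>
    have hk : ((z (Fin.last 2) : ℤ) : ZMod M) = ((z' (Fin.last 2) : ℤ) : ZMod M) := hzz.2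
    rw [ZMod.intCast_eq_intCast_iff_dvd_sub] at hk
    have hltM : |z' (Fin.last 2) - z (Fin.last 2)| < (M : ℤ) :=
      lt_of_lt_of_le (hlt _) (by exact_mod_cast hLM)
    have h0 := Int.eq_zero_of_abs_lt_dvd hk hltM
    linarith
  | cast j =>
    have hk : ((z (Fin.castSucc j) : ℤ) : ZMod L) = ((z' (Fin.castSucc j) : ℤ) : ZMod L) := by
      have := congrFun hzz.1 j
      simpa using this
    rw [ZMod.intCast_eq_intCast_iff_dvd_sub] at hk
    have h0 := Int.eq_zero_of_abs_lt_dvd hk (hlt _)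
    linarith

/-! ### Near pairs: Garban–Spencer on the space-time torus -/

variable [MeasurableSpace Circle] [BorelSpace Circle]

/-- **Near-pair long-range order of the `(2+1)`-D XY rotor, RP-free.** There are constants
`C, K₁ > 0` such that for all `K ≥ K₁`, all `L, M ≥ 1` with `L ≤ M` and all `x, y ∈ ℤ²` with
`16‖x − y‖₂² < L²`, the XY model `exp(K ∑_{(s,μ)} cos(θ_{s+e_μ} − θ_s)) dθ` on the bond system of
the space-time torus `(ℤ/L)² × ℤ/M` satisfies
`1 − ⟨cos(θ_{(πx,0)} − θ_{(πy,0)})⟩_K ≤ √(C/K)`.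
Proof: Garban–Spencer 2022, proof of Thm. 1.3 (the tree's deterministic estimate
`BondSystem.one_sub_expect_one_cosDiff_le`: Nishimori gauge identity, path identity, estimator,
Lemma 2.5, Messager–Miracle-Solé–Pfister), applied on the torus to the push-forward through
SPACE-TIME `ℤ³` of the tree's ball-path ensemble (`BallPath.Frame.chainOf`; overlaps controlled by
near-meetings with exponential tails, `card_meetCount_ge_le`); no reflection positivity, no parity
or translation-invariance hypothesis is used. [cite: GarbanSpencer2022, Theorem 1.3 with Remark 1] -/
theorem xyRotor_near_twoPoint :
    ∃ C K₁ : ℝ, 0 < C ∧ 0 < K₁ ∧ ∀ K : ℝ, K₁ ≤ K → ∀ (L M : ℕ) [NeZero L] [NeZero M], L ≤ M →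
      ∀ x y : Site 2, 16 * ∑ i, ((x i : ℝ) - (y i : ℝ)) ^ 2 < (L : ℝ) ^ 2 →
        1 - (JCurrent.bondSystem 2 L M).expect K 1
            (cosDiff ((Torus.proj L x, 0) : JCurrent.SpaceTimeSite 2 L M) ((Torus.proj L y, 0))) ≤
          Real.sqrt (C / K) := by
  obtain ⟨Ls, hLs, htail⟩ := card_meetCount_ge_le
  -- constants (`d = 3` space-time dimensions)
  obtain ⟨c, hc⟩ : ∃ c : ℕ, c = 2 * (3 + 2) := ⟨_, rfl⟩
  have hc1 : (1 : ℝ) ≤ c := by rw [hc]; norm_num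
  have hLs1 : (1 : ℝ) ≤ Ls := by exact_mod_cast hLs
  refine ⟨48 * c * Ls, 16 * c * Ls, by positivity, by positivity, ?_⟩
  intro K hK L M _ _ hLM x y hxy
  have hK0 : 0 < K := lt_of_lt_of_le (by positivity) hK
  have hK16 : (16 : ℝ) ≤ K := le_trans (by nlinarith) hK
  set G' := JCurrent.bondSystem 2 L M with hG'
  -- space-time lifts `x̃ = (x, 0)`, `ỹ = (y, 0)` in `ℤ³`
  set xt : Site 3 := Fin.snoc x 0 with hxt
  set yt : Site 3 := Fin.snoc y 0 with hyt
  set g : Site 3 → JCurrent.SpaceTimeSite 2 L M := fun z =>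
    (Torus.proj L (fun j : Fin 2 => z (Fin.castSucc j)), ((z (Fin.last 2) : ℤ) : ZMod M)) with hg
  have hgx : g xt = (Torus.proj L x, 0) := by
    simp only [hg, hxt, Fin.snoc_castSucc, Fin.snoc_last, Int.cast_zero]
  have hgy : g yt = (Torus.proj L y, 0) := by
    simp only [hg, hyt, Fin.snoc_castSucc, Fin.snoc_last, Int.cast_zero]
  have hdist : ∑ i, ((xt i : ℝ) - (yt i : ℝ)) ^ 2 = ∑ i, ((x i : ℝ) - (y i : ℝ)) ^ 2 := by
    rw [Fin.sum_univ_castSucc]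
    simp only [hxt, hyt, Fin.snoc_castSucc, Fin.snoc_last, sub_self, Int.cast_zero]
    ring
  have hxy3 : 16 * ∑ i, ((xt i : ℝ) - (yt i : ℝ)) ^ 2 < (L : ℝ) ^ 2 := by rwa [hdist]
  -- the trivial case `x = y`
  by_cases hne : xt = yt
  · have hxy' : x = y := by
      funext j
      have := congrFun hne (Fin.castSucc j)
      simpa [hxt, hyt] using this
    subst hxy'
    have : (cosDiff ((Torus.proj L x, 0) : JCurrent.SpaceTimeSite 2 L M) ((Torus.proj L x, 0)) :
        (JCurrent.SpaceTimeSite 2 L M → Circle) → ℝ) = fun _ => 1 := funext fun θ => cosDiff_self _ θ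
    rw [this, G'.expect_one]
    simp only [sub_self]
    exact Real.sqrt_nonneg _
  -- frame, ball and ensemble in space-time `ℤ³`
  obtain ⟨F, hFx, hFy⟩ := Frame.exists_of_ne (le_refl 3) hne
  obtain ⟨Λ, hΛ⟩ := exists_ball_finset F.x F.y
  have hball : ∀ z : Site 3, (∑ i, ((z i : ℝ) - ((F.x i : ℝ) + (F.y i : ℝ)) / 2) ^ 2) ≤
      4 * ∑ i, ((F.x i : ℝ) - (F.y i : ℝ)) ^ 2 → z ∈ Λ := fun z hz => (hΛ z).2 hz
  haveI : Nonempty F.Rnd := ⟨fun _ => 0⟩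
  obtain ⟨ω₀⟩ := (inferInstance : Nonempty F.Rnd)
  have hx : F.x ∈ Λ := hball _ (F.mem_ball_of_mem_verts ω₀ List.mem_cons_self)
  have hy : F.y ∈ Λ := hball _ (F.mem_ball_of_mem_verts ω₀ (by
    rw [← F.getLast_verts ω₀]; exact List.getLast_mem _))
  have hinj : Set.InjOn g (Λ : Set (Site 3)) := by
    have h := spaceTimeProj_injOn_of_ball (M := M) hLM F.x F.y (by rw [hFx, hFy]; exact hxy3) Λ
      fun z hz => (hΛ z).1 hz
    simpa only [hg] using h
  set T : F.Rnd → (latticeBonds Λ).UnitChain (⟨F.x, hx⟩ : ↥Λ) ⟨F.y, hy⟩ := F.chainOf hx hy hball with hT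
  -- push the ensemble forward to the space-time torus
  obtain ⟨T', hT'⟩ := exists_unitChain_latticeBonds_to_spaceTime (M := M) Λ g
    (![some 0, some 1, none] : Fin 3 → JCurrent.Dir 2) spaceTimeDir_injective
    (fun z i => by simp only [hg]; exact spaceTimeProj_step L M z i) hinj T
  have hTx : g ((⟨F.x, hx⟩ : ↥Λ) : Site 3) = (Torus.proj L x, 0) := by rw [← hgx]; simp [hFx]
  have hTy : g ((⟨F.y, hy⟩ : ↥Λ) : Site 3) = (Torus.proj L y, 0) := by rw [← hgy]; simp [hFy]
  set w : F.Rnd → ℝ := fun _ => (Fintype.card F.Rnd : ℝ)⁻¹ with hw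
  have hcard : (0 : ℝ) < Fintype.card F.Rnd := by exact_mod_cast Fintype.card_pos
  have hw0 : ∀ s, 0 ≤ w s := fun _ => by positivity
  have hw1 : ∑ s, w s = 1 := by
    rw [hw, Finset.sum_const, Finset.card_univ, nsmul_eq_mul, mul_inv_cancel₀ hcard.ne']
  -- the deterministic estimate on the torus
  have hest0 := G'.one_sub_expect_one_cosDiff_le hK0 _ _ w hw0 hw1 T'
  simp only [hT'] at hest0
  rw [← hTx, ← hTy]
  -- `κ = λ^{-2}`, `ρ = κ^c`
  set lam := vonMisesMean K with hlam
  have hlam0 : 0 < lam := vonMisesMean_pos hK0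
  have hlam1 : lam ≤ 1 := vonMisesMean_le_one hK0
  set κ : ℝ := (lam ^ 2)⁻¹ with hκ
  have hκ1 : 1 ≤ κ := by
    rw [hκ, one_le_inv₀ (by positivity)]; exact pow_le_one₀ hlam0.le hlam1
  have hκle : κ ≤ (1 + 2 / K) ^ 2 := by
    have h := inv_vonMisesMean_le hK0
    rw [hκ, ← inv_pow]
    exact pow_le_pow_left₀ (by positivity) h 2
  set ρ : ℝ := κ ^ c with hρ
  have hρ1 : 1 ≤ ρ := one_le_pow₀ hκ1
  have hcK : 2 * ((2 * c : ℕ) : ℝ) ≤ K := by push_cast; nlinarith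
  have hcLK : 2 * ((2 * c * Ls : ℕ) : ℝ) ≤ K := by push_cast; nlinarith
  have hρle : ρ ≤ 1 + 8 * c / K := by
    calc ρ ≤ ((1 + 2 / K) ^ 2) ^ c := pow_le_pow_left₀ (by positivity) hκle c
      _ = (1 + 2 / K) ^ (2 * c) := by rw [← pow_mul]
      _ ≤ 1 + 4 * ((2 * c : ℕ) : ℝ) / K := one_add_two_div_pow_le hK0 hcK
      _ = 1 + 8 * c / K := by push_cast; ring
  have hρL : ρ ^ Ls ≤ 3 / 2 := by
    have h16 : 4 * ((2 * c * Ls : ℕ) : ℝ) / K ≤ 1 / 2 := by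
      rw [div_le_iff₀ hK0]; push_cast; nlinarith
    calc ρ ^ Ls ≤ (((1 + 2 / K) ^ 2) ^ c) ^ Ls :=
          pow_le_pow_left₀ (by positivity) (pow_le_pow_left₀ (by positivity) hκle c) Ls
      _ = (1 + 2 / K) ^ (2 * c * Ls) := by rw [← pow_mul, ← pow_mul, mul_assoc]
      _ ≤ 1 + 4 * ((2 * c * Ls : ℕ) : ℝ) / K := one_add_two_div_pow_le hK0 hcLK
      _ ≤ 3 / 2 := by linarith
  -- the overlap moment
  have hmom : ∑ s, ∑ s', w s * w s' * κ ^ (T s).overlap (T s') ≤ 1 + 6 * Ls * (ρ - 1) := by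
    have hpair : ∀ s s', κ ^ (T s).overlap (T s') ≤
        ρ ^ meetCount (DyadicWalk.M F.T F.T) 0 (F.T + 1) ((s, s') : Pair F.T F.T) := by
      intro s s'
      rw [hρ, ← pow_mul]
      refine pow_le_pow_right₀ hκ1 ?_
      rw [hT]
      have h := F.overlap_chainOf_le hx hy hball s s'
      rw [hc]; exact h
    have htail' := htail F.T F.T (Nat.lt_two_pow_self).le
    have hmgf := sum_pow_le_of_tails
      (fun p : Pair F.T F.T => meetCount (DyadicWalk.M F.T F.T) 0 (F.T + 1) p) hLs
      (fun k => by simpa [DyadicWalk.cnt] using htail' k) hρ1 hρL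
    rw [Fintype.card_prod] at hmgf
    calc ∑ s, ∑ s', w s * w s' * κ ^ (T s).overlap (T s')
        ≤ ∑ s, ∑ s', w s * w s' * ρ ^ meetCount (DyadicWalk.M F.T F.T) 0 (F.T + 1) ((s, s') : Pair F.T F.T) :=
          Finset.sum_le_sum fun s _ => Finset.sum_le_sum fun s' _ =>
            mul_le_mul_of_nonneg_left (hpair s s') (mul_nonneg (hw0 s) (hw0 s'))
      _ = (Fintype.card F.Rnd : ℝ)⁻¹ ^ 2 *
            ∑ p : Pair F.T F.T, ρ ^ meetCount (DyadicWalk.M F.T F.T) 0 (F.T + 1) p := by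
          rw [Fintype.sum_prod_type, Finset.mul_sum]
          refine Finset.sum_congr rfl fun s _ => ?_
          rw [Finset.mul_sum]
          refine Finset.sum_congr rfl fun s' _ => ?_
          rw [hw]; ring
      _ ≤ (Fintype.card F.Rnd : ℝ)⁻¹ ^ 2 *
            ((1 + 6 * Ls * (ρ - 1)) * (Fintype.card F.Rnd * Fintype.card F.Rnd : ℕ)) :=
          mul_le_mul_of_nonneg_left hmgf (by positivity)
      _ = 1 + 6 * Ls * (ρ - 1) := by push_cast; field_simp
  -- conclusion
  have hfin : ∑ s, ∑ s', w s * w s' * κ ^ (T s).overlap (T s') - 1 ≤ 48 * c * Ls / K := by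
    calc ∑ s, ∑ s', w s * w s' * κ ^ (T s).overlap (T s') - 1 ≤ 6 * Ls * (ρ - 1) := by linarith
      _ ≤ 6 * Ls * (8 * c / K) := mul_le_mul_of_nonneg_left (by linarith) (by positivity)
      _ = 48 * c * Ls / K := by ring
  have hsq := Real.sqrt_le_sqrt hfin
  exact hest0.trans hsq

end Summit.HubbardSuperconductivity.HubbardSuperconductivity.Theorems

end
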